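import Summits.ValiantsHypothesis.ValiantsHypothesis.Theorems.FeketeSOSHard.Negative.LoadBearing

/-!
# Disproof attempts on `FeketeSOSHard` (crux `stmt-ValiantsHypothesis-3996`, route FeketeSOS)

Standing-adversary work file (cdisprove seat `refuter-cdisprove-stmt-ValiantsHypothesis-3996-0`, cycle 1,
2026-08-16).  Prose lives in docstrings; everything else is checked Lean (no `sorry`).  The conclusive parts are
LANDED and imported from `Theorems/FeketeSOSHard/Negative/LoadBearing.lean` (p74229) and
`Theorems/FeketeSOSHard/Negative/KillCriterion.lean` (p74971); this file keeps the read-back, the named variants,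
and the remarks.

## Findings

* `feketeSOSHard_iff` — the crux unfolded through `SOSHardAt δ p F`.  Read-back of the elaborated statement:
  the exponent is `(1:ℝ)/2 + δ` (real `rpow`), `legendreSym p 0 = 0` so `supp F_p = [1, p-1]`, `s ≤ p^δ` as
  reals, degrees via `natDegree ≤ p²`, weights `c_i ∈ ℂ` arbitrary.  Monotone in `δ`; not vacuous (`s = 2`,
  `F = ((F+1)/2)² − ((F−1)/2)²` is a representation for `p ≥ 2^{1/δ}`).  No mis-typing found.
* (a) LOAD-BEARING hypotheses (landed, `Negative/LoadBearing.lean`):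
  - `feketeSOSHard_false_without_prime` : Legendre ↦ Jacobi, all moduli `N ≥ N₀` — FALSE at `N = q²`
    (digit product `(∑_{0<k<q} x^k)(∑_{j<q} x^{qj})`, support-sum `< 4√N`).  Needed: non-principality of `χ`.
  - `feketeSOSHard_false_without_legendre` : `χ_p ↦` arbitrary `±1` pattern on `[1,p-1]` — FALSE for every
    prime via the all-ones pattern (4 squares, support-sum `≤ 6√p + 4`).  Needed: the actual values of `χ_p`;
    the near-extremal-covering structure of the supports alone carries no exponent.
  Here: the variants as named Props (`FeketeSOSHardWithoutPrime`, `FeketeSOSHardWithoutLegendre`), that they imply the crux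
  (`feketeSOSHard_of_withoutPrime`, `feketeSOSHard_of_withoutLegendre`), and their negations restated from the landed theorems.
* (b) KILL CRITERION (landed, `Negative/KillCriterion.lean`): `feketeSOSHard_false_of_cheapProducts` — few cheap
  products `F_p = ∑_{l<r} A_l B_l` (`r + r ≤ p^δ`, `2∑(|A_l|+|B_l|) < p^{1/2+δ}`) for infinitely many `p` and every
  `δ` kill the crux; rank-`r` factorisations of tiling matrices `(χ_p(1+u+v))_{S₁×S₂}` are such.  TIGHTNESS / what
  characters give — `digitRank_remark`: provable rank `≈ log p`, needed `p^δ`, measured `≈ √p` (census inside).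
* (c) NATURAL STRENGTHENINGS refuted: (a) are refutations of "all moduli" / "all sign patterns".  The cyclic
  strengthening (mod `x^p − 1`) is NOT refuted and not degenerate for sparse squares — `cyclic_remark` (with the
  Gauss-product closed form `F_p ≡ ±x^c ∏_{h∈H}(x^h − 1)`).
* (d) Targets: none yet (payload.targets = [] — no line picked).
* (e) Why it resists — `resists_remark`; small models — `smallp_remark` (`S_min(F_p) = p` at `p = 5, 7`).
* Compute (kit, `--workitem stmt-ValiantsHypothesis-3996`): j007992 digit-rank census `p ≤ 1500` + samples to 39043 (DONE,
  folded into `digitRank_remark`); j009416 mixed-radix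
  tiling-rank census `p ≤ 2500` (DONE, folded into `digitRank_remark`); j009087 EXACT minimum SOS support-sum of `F_p` for `p = 5, 7, 11, 13` (Gröbner
  feasibility over ℚ per support pattern, `s ≤ 3–4`, `deg < p` resp. `< 12`) — DONE (wall-clock cut at
  `p = 11`, `T = 10`): `S_min(F_5) = 5`, `S_min(F_7) = 7`, `S_min(F_11) ≥ 9` (`smallp_remark`); follow-up j014565 queued.
-/

namespace Summit.ValiantsHypothesis.ValiantsHypothesis.Cruxes.FeketeSOSHard.Disproof

open Polynomial Finset
open Summit.ValiantsHypothesis.ValiantsHypothesis.Theses.FeketeSOS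
open Summit.ValiantsHypothesis.ValiantsHypothesis.Theorems.FeketeSOSHard.Negative

noncomputable section

/-! ## The crux, unfolded -/

/-- `SOSHardAt δ p F`: every weighted SOS representation `F = ∑_{i<s} c_i g_i²` over `ℂ` with `s ≤ p^δ`
squares of degree `≤ p²` has support-sum `∑_i |supp g_i| ≥ p^{1/2+δ}` — verbatim the inner block of the crux
`FeketeSOS.FeketeSOSHard`, with the target polynomial `F` and the size parameter `p` exposed. [folklore] -/
def SOSHardAt (δ : ℝ) (p : ℕ) (F : ℂ[X]) : Prop :=
  ∀ (s : ℕ) (c : Fin s → ℂ) (g : Fin s → ℂ[X]), (s : ℝ) ≤ (p : ℝ) ^ δ →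
    (∀ i, (g i).natDegree ≤ p ^ 2) → (∑ i, C (c i) * g i ^ 2) = F →
    (p : ℝ) ^ (1 / 2 + δ) ≤ ∑ i, ((g i).support.card : ℝ)

/-- The Fekete polynomial over `ℂ` exactly as rendered in the crux: `∑_{m<p} (m|p) X^m`. [folklore] -/
def fekete (p : ℕ) [Fact p.Prime] : ℂ[X] :=
  ∑ m ∈ range p, C ((legendreSym p m : ℤ) : ℂ) * X ^ m

/-- Read-back: the crux is literally `∃ δ > 0, ∃ p₀, ∀ primes p ≥ p₀, SOSHardAt δ p (fekete p)` (by `Iff.rfl`). -/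
theorem feketeSOSHard_iff :
    FeketeSOSHard ↔ ∃ δ : ℝ, 0 < δ ∧ ∃ p₀ : ℕ, ∀ (p : ℕ) [Fact p.Prime], p₀ ≤ p → SOSHardAt δ p (fekete p) :=
  Iff.rfl

/-- At a prime modulus the landed `jacobiFekete` is the crux's Fekete polynomial. -/
theorem fekete_eq_jacobiFekete (p : ℕ) [Fact p.Prime] : fekete p = jacobiFekete p := by
  unfold fekete jacobiFekete
  exact sum_congr rfl fun m _ => by rw [jacobiSym.legendreSym.to_jacobiSym]

/-! ## (a) Load-bearing hypotheses: the named variants and their refutations (from the landed file) -/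

/-- VARIANT: the crux WITHOUT primality of the modulus — SOS-hardness of `∑_{m<N} J(m|N) x^m` for all large
moduli `N` (Jacobi symbol).  The crux is its restriction to prime `N`. -/
def FeketeSOSHardWithoutPrime : Prop :=
  ∃ δ : ℝ, 0 < δ ∧ ∃ N₀ : ℕ, ∀ N : ℕ, N₀ ≤ N → SOSHardAt δ N (jacobiFekete N)

/-- The dropped-primality variant implies the crux. -/
theorem feketeSOSHard_of_withoutPrime : FeketeSOSHardWithoutPrime → FeketeSOSHard := by
  rintro ⟨δ, hδ, N₀, h⟩
  rw [feketeSOSHard_iff]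
  exact ⟨δ, hδ, N₀, fun p _ hp => by rw [fekete_eq_jacobiFekete]; exact h p hp⟩

/-- **Primality is load-bearing** (landed as `Negative.feketeSOSHard_false_without_prime`): the variant fails at
every large prime square `N = q²`, where the Jacobi–Fekete polynomial is the digit product
`(x + ⋯ + x^{q-1})(1 + x^q + ⋯ + x^{q(q-1)})`, 4 squares, support-sum `< 4√N`. -/
theorem not_feketeSOSHardWithoutPrime : ¬ FeketeSOSHardWithoutPrime :=
  feketeSOSHard_false_without_prime

/-- VARIANT: the crux WITHOUT the Legendre symbol — SOS-hardness for EVERY sign pattern `ε : ℕ → ℤ` with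
`ε 0 = 0` and `ε m = ±1` for `0 < m < p` (`p` prime kept).  The crux is the case `ε = legendreSym p`. -/
def FeketeSOSHardWithoutLegendre : Prop :=
  ∃ δ : ℝ, 0 < δ ∧ ∃ p₀ : ℕ, ∀ (p : ℕ) [Fact p.Prime], p₀ ≤ p → ∀ ε : ℕ → ℤ, ε 0 = 0 →
    (∀ m, 0 < m → m < p → (ε m = 1 ∨ ε m = -1)) →
    SOSHardAt δ p (∑ m ∈ range p, C ((ε m : ℤ) : ℂ) * X ^ m)

/-- The dropped-Legendre variant implies the crux (`legendreSym p m = ±1` for `0 < m < p`). -/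
theorem feketeSOSHard_of_withoutLegendre : FeketeSOSHardWithoutLegendre → FeketeSOSHard := by
  rintro ⟨δ, hδ, p₀, h⟩
  rw [feketeSOSHard_iff]
  refine ⟨δ, hδ, p₀, fun p hp hp₀ => ?_⟩
  have hε : ∀ m : ℕ, 0 < m → m < p → (legendreSym p m = 1 ∨ legendreSym p m = -1) := fun m hm hmp => by
    apply legendreSym.eq_one_or_neg_one
    rw [Int.cast_natCast, Ne, ZMod.natCast_eq_zero_iff]
    exact Nat.not_dvd_of_pos_of_lt hm hmp
  exact h p hp₀ (fun m => legendreSym p m) (by simp) hε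

/-- **The values of `χ_p` are load-bearing** (landed as `Negative.feketeSOSHard_false_without_legendre`): for every
prime the all-ones pattern `x + ⋯ + x^{p-1}` has a 4-square representation of support-sum `≤ 6√p + 4`
(digit tiling `p − 1 = ab + r`), so the trivial bound `√(2p)` is tight up to a constant for full-support `±1`
polynomials: the covering combinatorics of the supports carries no exponent. -/
theorem not_feketeSOSHardWithoutLegendre : ¬ FeketeSOSHardWithoutLegendre :=
  feketeSOSHard_false_without_legendre

/-! ## (b) Kill criterion — landed as `Negative/KillCriterion.lean` (p74971):
`feketeSOSHard_false_of_cheapProducts : (∀ δ > 0, ∀ p₀, ∃ prime p ≥ p₀, ∃ r (A B : Fin r → ℂ[X]),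
r + r ≤ p^δ ∧ deg ≤ p² ∧ ∑ A_l B_l = F_p ∧ 2∑(|A_l|+|B_l|) < p^{1/2+δ}) → ¬ FeketeSOSHard`, via `prodG_sum`
(`∑ A_l B_l` as `r + r` weighted squares).  Not re-imported here only because this work file is checked against a
farm snapshot that may predate that module; import it directly in scratch checks. -/

/-! ## (b), (c), (e): remarks (anchored on trivial theorems so that the index above resolves) -/

/-- **Digit-rank reformulation — what a kill must look like, and what characters give.**
For a digit tiling `m = 1 + k + a·j` (`0 ≤ k < a`, `0 ≤ j < b`, `ab ≥ p-1`) put `M = (χ_p(1+k+aj))_{j,k}`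
(entries with `1+k+aj ≥ p` set to `0`, as an exact identity requires).  A rank-`r` factorisation
`M = ∑_{l<r} β_l α_lᵀ` over `ℂ` is exactly an identity `F_p = ∑_{l<r} A_l(x)·B_l(x^a)` with `|supp A_l| ≤ a`,
`|supp B_l| ≤ b`, hence (by `sqg_sum`, two products at a time) an SOS representation with `s = 2r` (r even) squares
of degree `< p` and support-sum `≤ 2r(a+b) ≈ 4r√p`.  So the crux with gain `δ` FORCES `rank M ≥ p^δ/4` for every
balanced `a`, and more generally rank `≥ p^δ/4` for the coefficient matrix of every near-tiling
`[1,p-1] ⊆ S₁ + S₂`, `|S₁||S₂| ≤ p^{1+2δ}`; a refutation along these lines needs rank `p^{o(1)}` for infinitely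
many `p` — the "Gauss-sum-type identity" of the planner's caveat, made concrete.
What characters give cheaply in the other direction: summing the squares of all contiguous `r × r` minors over the
`≈ p` positions and bounding the non-square monomials (products of `2r` shifted `χ`'s, degree `2r`, not squares
since `u + a v` determines `(u,v)` for `u < a`) by Weil, `rank M ≥ r` follows once `r!·(2r)·√p < p/2`, i.e.
`rank M ≥ c·log p / log log p` — a sub-power bound, consistent with "characters alone give constants/logs, not an
exponent".  Two more cheap bounds of the same strength: (Odlyzko) a rank-`r` `±1` matrix has at most `2^r` distinct
rows, and two equal rows `j ≠ j'` mean `χ_p(n)χ_p(n+d) = 1` along an interval of length `a`, impossible for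
`a ≥ 3√p log p` by Weil + completion — so UNBALANCED tilings (`a = p^{1/2+ε}`, `b = p^{1/2−ε}`) have rank
`≥ (1/2 − ε) log₂ p − 1`; (spectral) for `S₁ + S₂ ⊆ [0, p−2]` the matrix is a submatrix of the conference-type
Hankel-circulant `(χ_p(1+u+v))_{u,v ∈ ℤ/p}` (all non-trivial singular values `√p`), so rank `≥ |S₁||S₂|/p`, which at
the tiling threshold `|S₁||S₂| ≈ p` is `≥ 1` only (it becomes `p^{2δ'}` for fat coverings `|S₁||S₂| = p^{1+2δ'}`,
but there anti-diagonal sums, not entries, are prescribed and rank is the wrong invariant).  Random `±1` matrices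
of size `√p` have full rank with probability `1 − exp(−c√p)`; the needed `p^δ` sits between `log p` (provable) and
`√p` (measured) — an explicit-matrix-rank problem at the square-root threshold, rigidity-flavoured.
Measured (kit job j007992, `compute-j007992.json` on the item; exact rank via FLINT): all 237 primes `5 ≤ p ≤ 1500`,
every `a ∈ [√p/2, 2√p+2]`, partial top row dropped or kept, plus 80 sampled primes up to `39043` at `a ≈ √p` —
19572 matrices: 103 are rank-deficient at all; the deficiency `min(a,b) − rank` is `≤ 2` except `p = 197, a = b = 14`
(rank 10), `p = 257, a = b = 16` (rank 13) and `p = 179, a = 14` (rank 10 of 13); for `p > 300` only 8 matrices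
(at `p = 307, 487, 677`) are deficient, each by exactly 1, and for every `p > 600` the ratio `rank / min(a,b)` is
`≥ 0.96` (the minimum `25/26` is the forced case `p = 677 = 26² + 1` below); at `p = 39043` the `98 × 398`,
`196 × 199` digit matrices have full rank.
The only SYSTEMATIC deficiency found is explained: for `p = a² + 1` the map `m ↦ a·m` (`a² ≡ −1`) rotates the
`a × a` digit square by 90°, `M = χ(a)·rot(M)`, and for `a ≡ 2 (mod 4)` (`χ(a) = −1`) this forces `det M = 0`
(deficiency exactly 1 at `a = 2, 6, 10, 26, 54, 66, 74, 90, 94`; 4 at `a = 14`, and 3 at `a = 16` where `χ(a)=1`);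
for `a ≡ 0 (mod 4)` the square digit matrix is non-singular at `a = 4, 20, 24, 36, 40, 56, 84`.  Mixed-radix
tilings (kit job j009416: `S₁ + S₂ = [0,N)`, `N ∈ [p−1, p+11]`, every ordered radix system with factors `≤ 16`, every
level bipartition with both sides `≤ 3√N`; 364 primes `7 ≤ p ≤ 2477`, median ≈ 2000 tilings per prime): the best SOS
bound `2r(|S₁|+|S₂|)` obtained from ANY tiling is `≥ 2.22 (p−1)` for every `p ≥ 100` (median `2.29 (p−1)`), never
below `p − 1`; the minimum of `rank / min(|S₁|,|S₂|)` is `0.714` at `p = 197` (the `14 × 14` case again), `0.94` on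
`300 ≤ p < 700`, `0.97` on `700 ≤ p < 1500` and exactly `1` (every tiling of full rank) for all `1500 ≤ p ≤ 2477`;
the largest deficiencies are 4 (`p = 197`; `p = 257` with the bit-interleaved `16 × 16` tiling of `256 = 2⁸`, rank 12)
and 3 (`p = 29, 53, 179`).  So no low-rank additive structure is visible: digit/tiling rank `≈` full `≈ √p`. -/
theorem digitRank_remark : True := trivial

/-- **Small models: the exact minimum SOS support-sum of `F_p` is `p` at `p = 5, 7` (kit job j009087, `compute-j009087.json`).**
Weights absorbed (`c_i = 1` over `ℂ`), support patterns `(S_1,…,S_s)` enumerated by total size `T = ∑|S_i|`, pruned by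
necessary conditions valid for the minimum (every `m ∈ [1,p−1]` produced by some pair inside one `S_i`; no position
`m = 0` or `m ≥ p` produced by exactly one pair), and FEASIBILITY OVER `ℂ` of each surviving pattern decided exactly
(Gröbner basis over `ℚ` of the coefficient equations `≠ {1}`, Nullstellensatz; sympy 1.14), numerical witnesses
(residual `< 10⁻¹⁵`) attached to every feasible pattern:
* `p = 5` (`s ≤ 4`, `deg < 10`): nothing at `T ≤ 4`; `S_min(F_5) = 5` with 6 minimal patterns —
  `{0,1,2}+{0,1}`, `{0,1,2}+{0,2}`, `{0,1,3}+{0,3}` (two squares) and `{0,1,2}+{1}+{0}`, `{0,1,2}+{2}+{0}`,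
  `{1,2}+{0,1}+{0}` (three squares);
* `p = 7`: `S_min(F_7) = 7` both for (`s ≤ 4`, `deg < 7`: 62 minimal patterns — 3 with two squares, 38 with three,
  21 with four; all 23 candidates with `T ≤ 6` infeasible) and for (`s ≤ 3`, `deg < 12`: 41 minimal patterns, all
  supported in `[0,3] = [0,(p−1)/2]`, i.e. cancellation-free; all 23 candidates with `T ≤ 6` infeasible);
* `p = 11` (`s ≤ 3`, `deg < 11`): every pattern with `T ≤ 8` is infeasible (452 Gröbner certificates `{1}`); at `T = 9`,
  1864 of the 1868 candidates are infeasible and 4 two-square patterns (`{0,1,2,3,5}+{0,3,4,5}`, `{0,2,3,4,5}+{0,1,2,5}`,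
  `{0,2,3,4,5}+{0,1,3,5}`, `{0,2,3,4,5}+{0,1,4,5}`) hit the 60 s GB timeout — so `S_min(F_11) ≥ 9` for three squares
  (`≥ 10` unless one of those four products exists); the level `T = 10` was cut by the job's wall clock (follow-up job
  j014565: `p = 11, 13` in the cancellation-free regime `deg ≤ (p−1)/2`, `s ≤ 4`, and `deg < 8`, `s ≤ 3`).
So at the smallest primes the minimum support-sum is `p`, above `|supp F_p| = p − 1` and far above the trivial bound
`⌈√(2p)⌉ = 3, 3, 4`: no square-root economy whatsoever — the Fekete polynomial behaves like a GENERIC polynomial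
(DST24: generic `S = Θ(sparsity)`), which is exactly what the crux bets on asymptotically. -/
theorem smallp_remark : True := trivial

/-- **The cyclic relaxation is not degenerate for sparse squares (a cleaner, stronger target — not refuted).**
Mod `x^p − 1` the Fekete polynomial has two classical closed forms: (i) for `p ≡ 1 (mod 4)`,
`F_p ≡ J(ψ,ψ)⁻¹ (∑_t ψ(t) x^t)^{*2}` (ψ a quartic character, Jacobi sum): ONE square, but a dense one (support
`p − 1`); (ii) for every odd `p` and every half-system `H ⊂ (ℤ/p)ˣ` (e.g. `H = {1,…,(p−1)/2}`),
`F_p ≡ ± x^c ∏_{h∈H} (x^h − 1)  (mod x^p − 1)` — Gauss's product formula for the Gauss sum made equivariant by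
Gauss's lemma (`∏_h (ζ^{th} − ζ^{−th}) = χ(t) ∏_h (ζ^h − ζ^{−h})`); checked here for all `p ≤ 31`
(`p = 5`: `F_5 = x(x−1)(x²−1)` exactly; `p = 7`: `F_7 = (x−1)(x²−1)(x⁴−1) − (x⁷−1)` with `H = QR`).  So cyclically
`F_p` is a product of `(p−1)/2` binomials — tiny as a `ΠΣ` circuit, useless for `Σ∧²ΣΠ`: grouping the binomials
into two factors `A·B` makes each factor dense, because the subset sums of `≥ √(2p)` distinct exponents cover `ℤ/p`
(Dias da Silva–Hamidoune) and, decisively, the sibling crux's char-`p` bound `|supp Ā| + |supp B̄| ≥ (p+3)/2` for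
cyclic splittings; as honest polynomials `∏_{h∈H}(x^h − 1)` has `≥ |H|(|H|+1)/2 + 1 ≈ p²/8` terms (distinct subset
sums), so the exact correction `(x^p − 1)·W` is dense too.
For sparse data the cyclic problem keeps its teeth: on the Fourier side it reads
`∑_{i<s} c_i ĝ_i(t)² = G(χ_p)·χ_p(t)` for all `t ∈ ℤ/p` with sparse exponential sums `ĝ_i`; for `s = 1`,
`|ĝ(t)|² = const` on `t ≠ 0` and `ĝ(0) = 0` force the autocorrelation of `g` to equal `−C/p ≠ 0` at EVERY
nonzero shift, so `supp g − supp g = ℤ/p` (`|supp g| ≥ √p`), and on an exact planar difference set the weights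
are forced equal, contradicting `∑ g = 0`; the parameter count (`∑|S_i|` unknowns, `p` equations) puts generic
cyclic solutions at support-sum `≈ p` as well.  The sibling crux's card `cyclic-valuation-dichotomy`
(Cruxes/FeketeNoSparseSplit) proves the cyclic `s = 2` case with the linear bound `(p+3)/2` (char-`p` multiplicity
`(x−1)^{(p−1)/2} ∥ F̄_p`); that lever is multiplicative and says nothing for `s ≥ 3`, where cancellation between
squares of different valuation defeats reduction at a place above `p`. -/
theorem cyclic_remark : True := trivial

/-- **Why it resists (cycle 1) / near-misses.**
(i) No identity is known writing `χ_p` additively from few sparse autoconvolutions.  Theta products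
`θ(q)θ(q^N)` (supports `√x`) produce the divisor sums `(1 * χ_{−4N})(n)`, i.e. `χ` convolved multiplicatively with
`1` — undoing that needs Möbius inversion, which is multiplicative, not additive: near-miss, no representation.
(ii) Gauss periods of index `e`: squares of `H`-invariant sparse sums (support `(p−1)/e` per period) stay in the
`(e+1)`-dimensional period algebra and `G·χ_p = ∑_j (−1)^j η_j` lies there (`e` even), but matching it needs
`s·r ≳ e` free coefficients, i.e. support-sum `s·r·(p−1)/e ≈ p`: cyclotomy gives no gain by parameter count; a gain
would be a miraculous identity among cyclotomic numbers of order `e ≈ √p`, none known for prime fields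
(uniform cyclotomy lives over `𝔽_{p^{2k}}`).
(iii) The `s = 2` shadow is provably hard with a LINEAR bound (sibling crux), and exhaustive ℂ-factorisation minima
for `p ≤ 29` are `≥ 0.74 p` (route-review evidence on stmt-3997): no sparse structure at all at small `p`.
(iv) Parameter counting in every structured ansatz tried (digit/tensor rank, subgroup-equivariant supports,
period algebra) returns support-sum `≈ p`, i.e. the GENERIC value `Θ(d)` of DST24; the crux only asks `p^{1/2+δ}`.
(v) The two `_false_without_` theorems pin what any proof must use: non-principality and the actual values of
`χ_p`.  Verdict for provers: probably true and of "open-problem" grade, exactly as filed; the concrete invariant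
to attack is the digit/near-tiling rank of `χ_p` (remark above), where the needed `p^δ` sits far above what
completed character sums give (`log p/log log p`) and far below what is measured (full rank `≈ √p`). -/
theorem resists_remark : True := trivial

end

end Summit.ValiantsHypothesis.ValiantsHypothesis.Cruxes.FeketeSOSHard.Disproof
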